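import Summits.CriticalPhenomena.PercolationContinuityZ3.Theorems.Transplant.SkelFrmFromBParamsFaceFloorsTXA
import Summits.CriticalPhenomena.PercolationContinuityZ3.Theorems.Transplant.SkelFrmBParamsFaceFloorsTXA
import Summits.CriticalPhenomena.PercolationContinuityZ3.Theorems.Transplant.SkelFrmFromBChoiceNums
import Summits.CriticalPhenomena.PercolationContinuityZ3.Theorems.Transplant.SkelFrmBChoiceNums
import Summits.CriticalPhenomena.PercolationContinuityZ3.Theorems.Transplant.PlanarSkeletonFrmFromDefs
import Summits.CriticalPhenomena.PercolationContinuityZ3.Theorems.Transplant.PlanarSkeletonFrmDefs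
import Summits.CriticalPhenomena.PercolationContinuityZ3.Theorems.Transplant.SkelPhiStepIDataNS
import HarnessLib
import Summits.CriticalPhenomena.PercolationContinuityZ3.Theorems.Transplant.SkelFrmBParamsFaceRunA
/-!
# U-WAVE PORT (RULING D-U, lead g21 2026-08-26; WAVE-U-MANIFEST v3.1 row «SkelFrmBParamsFaceRunA» ↦ «SkelFrmFromBParamsFaceRunA») of the tree module
# `Transplant/SkelFrmBParamsFaceRunA` onto the carrier `PlanarSkeletonFrmFrom` (frames only, cylinders connected from width `ℓ₀` on)

ORIGINAL TITLE: (F) VALUE LAYER, N2 twin (hp-8 g42, 2026-08-23; F-DISCHARGE-MAP-N2 G8/G18): `port_frm.py` text of N1 `SkelNegBParamsFaceRunA` (stmt-g16) — the tangential start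

builds on p205010 (kernel theorem, internal audit signed; external expert review pending) — nothing in this file uses p205010; NOTHING is claimed about the
OPEN node U `SamePDropOfSkeletonFrmFrom₁` (nor U_s / the end state).  Lane `prim-bschramm`, seat `prim-bschramm-stmt` gen 26 (port pen, RULING M-11 family P-stmt; tool = p3-g26's port_u.py of record, registry-driven inputs); helper file
(`--supports stmt-CriticalPhenomena-4575 --as helper`).  PORT RULES r1–r4 of RULING D-U: declaration order and proof texts are those of the original,
byte-identical except (i) the carrier token `PlanarSkeletonFrm ↦ PlanarSkeletonFrmFrom` (binders, `namespace`/`end` lines, qualified names of twinned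
declarations), (ii) carrier-FREE declarations of the original (φ-level `Skelφ…` blocks and namespace-only arithmetic residents) are NOT re-declared —
this file imports the original and `export`s the twin-free residents (POLICY T / treatment (m1)); residents whose statement mentions a twinned
constant are copied, (iii) every carrier-binding declaration keeps its explicit binder `(Φ : PlanarSkeletonFrmFrom G)` in its own signature (r2).  Docstrings and citations are the original's.
-/

noncomputable section

open scoped Classical

namespace Summit.CriticalPhenomena.PercolationContinuityZ3.Theorems.Transplant

namespace PlanarSkeletonFrmFrom

namespace NegB

open Literature.Probability.Percolation Literature.Probability.LatticeModels SimpleGraph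
open SkelConc (Consts)
open Skelφ (shearUnit shearUnit_pos)
open Skelφ.StepI (DataN)
open Neg

namespace KS

section Q3

/-- **The x-face's tangential (y′-run) start half-width of the (ζ′) chain** `qB3XA R′ := W + 1000·Kq·R′ + 2`. [this work] -/
def qB3XA (κ : Consts) {V : Type} [DecidableEq V] [Countable V] {G : SimpleGraph V} [G.LocallyFinite] (Φ : PlanarSkeletonFrmFrom G) (t : V) (p : unitInterval) (D : Skelφ.StepI.DataNS V) (g : ℕ) (f : ℕ) (R' : ℕ) : ℕ := Wrun κ Φ t p D g f + 1000 * Neg.Kq κ * R' + 2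

/-- **The y′-face's tangential (x-run) start half-width of the (ζ′) chain** `qB3YA R′ := 2n_L + 1000·Kq·R′`. [this work] -/
def qB3YA (κ : Consts) {V : Type} [DecidableEq V] [Countable V] {G : SimpleGraph V} [G.LocallyFinite] (Φ : PlanarSkeletonFrmFrom G) (t : V) (p : unitInterval) (D : Skelφ.StepI.DataNS V) (g : ℕ) (f : ℕ) (R' : ℕ) : ℕ := 2 * nL κ Φ t p D g f + 1000 * Neg.Kq κ * R'

/-- **`hq₃` (x-face, (ζ′))**: `W + (N_r+1)·R′ + 2 ≤ qB3XA R′` whenever `N_r + 1 ≤ 1000·Kq`. [folklore] -/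
theorem hq₃X_RA (κ : Consts) {V : Type} [DecidableEq V] [Countable V] {G : SimpleGraph V} [G.LocallyFinite] (Φ : PlanarSkeletonFrmFrom G) (t : V) (p : unitInterval) (D : Skelφ.StepI.DataNS V) (g : ℕ) (f : ℕ) (R' : ℕ) {Nr : ℕ} (hNr : Nr + 1 ≤ 1000 * Neg.Kq κ) :
    ((nL κ Φ t p D g f * ℓL κ Φ t p D g f / shearUnit (nL κ Φ t p D g f) (hL κ Φ t p D g f) + 1 : ℕ) : ℤ) + ((Nr : ℤ) + 1) * R' + 2 ≤
      (qB3XA κ Φ t p D g f R' : ℤ) := by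
  unfold qB3XA Wrun
  have h : ((Nr : ℤ) + 1) * R' ≤ 1000 * (Neg.Kq κ : ℤ) * (R' : ℤ) := by
    have : ((Nr : ℤ) + 1) ≤ ((1000 * Neg.Kq κ : ℕ) : ℤ) := by exact_mod_cast hNr
    push_cast at this
    exact mul_le_mul_of_nonneg_right this (by positivity)
  push_cast; linarith

/-- **`hq₃` (y′-face, (ζ′))**: `2n_L + (N_r+1)·R′ ≤ qB3YA R′` whenever `N_r + 1 ≤ 1000·Kq`. [folklore] -/
theorem hq₃Y_RA (κ : Consts) {V : Type} [DecidableEq V] [Countable V] {G : SimpleGraph V} [G.LocallyFinite] (Φ : PlanarSkeletonFrmFrom G) (t : V) (p : unitInterval) (D : Skelφ.StepI.DataNS V) (g : ℕ) (f : ℕ) (R' : ℕ) {Nr : ℕ} (hNr : Nr + 1 ≤ 1000 * Neg.Kq κ) :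
    2 * (nL κ Φ t p D g f : ℤ) + ((Nr : ℤ) + 1) * R' ≤ (qB3YA κ Φ t p D g f R' : ℤ) := by
  unfold qB3YA
  have h : ((Nr : ℤ) + 1) * R' ≤ 1000 * (Neg.Kq κ : ℤ) * (R' : ℤ) := by
    have : ((Nr : ℤ) + 1) ≤ ((1000 * Neg.Kq κ : ℕ) : ℤ) := by exact_mod_cast hNr
    push_cast at this
    exact mul_le_mul_of_nonneg_right this (by positivity)
  push_cast; linarith

end Q3

section Fit

/-- **`hfit` ((ζ′))**: `qB + (N_r+1)·R′ ≤ n_L` for every start half-width with `4qB ≤ n_L`, every `R′ ≤ RA′` and `N_r + 1 ≤ 1000·Kq`, given the (ζ′) floor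
`2000·Kq·(RA′+2) ≤ n_L` (`KS.nL_floorsA.1` at `f := fT 0 fxA`). [folklore] -/
theorem hfitX_RA (κ : Consts) {V : Type} [DecidableEq V] [Countable V] {G : SimpleGraph V} [G.LocallyFinite] (Φ : PlanarSkeletonFrmFrom G) (t : V) (p : unitInterval) (D : Skelφ.StepI.DataNS V) (g : ℕ) (f : ℕ) (mk : ℕ) {qB R' Nr : ℕ} (hq : 4 * qB ≤ nL κ Φ t p D g f) (hR : R' ≤ KS0.R'0 κ Φ t p D mk) (hNr : Nr + 1 ≤ 1000 * Neg.Kq κ)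
    (hnA : 2000 * Neg.Kq κ * (KS0.R'0 κ Φ t p D mk + 2) ≤ nL κ Φ t p D g f) :
    (qB : ℤ) + ((Nr : ℤ) + 1) * R' ≤ (nL κ Φ t p D g f : ℤ) := by
  have hn : 2000 * (Neg.Kq κ : ℤ) * ((KS0.R'0 κ Φ t p D mk : ℤ) + 2) ≤ (nL κ Φ t p D g f : ℤ) := by exact_mod_cast hnA
  have a : ((Nr : ℤ) + 1) ≤ 1000 * (Neg.Kq κ : ℤ) := by
    have : ((Nr : ℤ) + 1) ≤ ((1000 * Neg.Kq κ : ℕ) : ℤ) := by exact_mod_cast hNr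
    push_cast at this; exact this
  clear hNr hnA
  have hq0 : (0 : ℤ) ≤ (Neg.Kq κ : ℤ) := Nat.cast_nonneg _
  have hR0 : (0 : ℤ) ≤ (KS0.R'0 κ Φ t p D mk : ℤ) := Nat.cast_nonneg _
  have b : (R' : ℤ) ≤ KS0.R'0 κ Φ t p D mk := by exact_mod_cast hR
  have h1 : ((Nr : ℤ) + 1) * R' ≤ 1000 * (Neg.Kq κ : ℤ) * (KS0.R'0 κ Φ t p D mk : ℤ) :=
    calc ((Nr : ℤ) + 1) * R' ≤ (1000 * (Neg.Kq κ : ℤ)) * (R' : ℤ) := mul_le_mul_of_nonneg_right a (by positivity)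
      _ ≤ (1000 * (Neg.Kq κ : ℤ)) * (KS0.R'0 κ Φ t p D mk : ℤ) := mul_le_mul_of_nonneg_left b (by positivity)
  have hq' : 4 * (qB : ℤ) ≤ nL κ Φ t p D g f := by exact_mod_cast hq
  have hKR : (0 : ℤ) ≤ (Neg.Kq κ : ℤ) * (KS0.R'0 κ Φ t p D mk : ℤ) := mul_nonneg hq0 hR0
  linarith

end Fit

end KS

end NegB

end PlanarSkeletonFrmFrom

end Summit.CriticalPhenomena.PercolationContinuityZ3.Theorems.Transplant

end
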